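import Summits.QuantumFields.YangMills.Theorems.UnitScaleTiltCoverSites
import HarnessLib

/-!
# Route `UnitScaleTilt`, crux K1 «MinimiserStabilityRegPr» (stmt-QuantumFields-19200), leaf `stub_halvingStep` — the (P2-small) branch by COVERING
# (★★OWNER RULING g26-№18 (α), brick α1 part 2): **THE PUSHFORWARD `π_*` ALONG THE COVERING MAP — sums over fibres, adjointness with the pullback,
# shift-equivariance of the fibres** (LEAD `ym-ust-19200-w5` g3's α3a request 08:28:27Z; ★★OWNER ACK 28 (1))

Cell `ym3-torus` (HUMAN RULING D-0037, YM ladder rung R3 — continuum SU(2) YM₃ on the torus is a RUNG, not the Clay problem), explicit-unit helper seat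
`ym-ust-19936-w8` gen 0.  Definitions lane (`push`, `pushBond`); `--supports stmt-QuantumFields-19200 --as helper`; counts toward nothing by itself.
A separate file (not a v1.1 append of ✓`…CoverSites`) only because of the 400-line rule.

WHY.  Brick α3 transports the flat-point operators (`∂`, `∂*`, `Δ`, `Q`, `Q*`, the gauge-fixing projection) between a torus and its `L^{jc}`-fold cover.  The FORWARD
stencils intertwine with the PULLBACK `f ↦ f ∘ π` by their formulas; their ADJOINTS intertwine with pullback exactly when the forward maps intertwine with the
PUSHFORWARD `(π_* g)(x) := Σ_{x̃ ∈ π⁻¹ x} g(x̃)` — the adjoint of the pullback for the counting pairings.  This file supplies `π_*` on site and bond functions, the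
adjointness identities, `π_* π^* = deg = (L^{jc})^d`, and the shift-equivariance `(π_* g)(x ± e_μ) = (π_* g(· ± e_μ))(x)` (the fibre of `x ± e_μ` is the shifted
fibre of `x`, because `π` commutes with the bijections `shift μ`∕`unshift μ` — ✓`proj_shift`∕`proj_unshift`).

WHAT IS DEFINED ∕ PROVED (namespace `…Theorems.CoverSites`): `push`∕`push_apply`, `sum_cover_site_eq_sum_push`, `push_add`, ★`push_comp_proj` (`π_*π^* = deg`),
★`sum_pullback_mul_eq_sum_mul_push` (adjointness), ★`push_shift`∕`push_unshift`; `pushBond`∕`pushBond_apply`, `sum_cover_bond_eq_sum_pushBond`,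
`pushBond_comp_projBond`, `sum_pullback_mul_eq_sum_mul_pushBond`.
HONEST SCOPE: finite-sum bookkeeping; no analysis; NOT a claim about the mass gap.

References: T. Bałaban, CMP **102** (1985) 277–309 [Balaban1985Variational] ((144) p.300, Thm 1 p.279); CMP **109** (1987) 249–301 [Balaban1987RG1] ((0.1)–(0.3)
pp.251–252); CMP **95** (1984) 17–40 [Balaban1984PropagatorsI] ((1.11) p.19 — the adjoint averaging `Q*`).
-/

open scoped BigOperators

namespace Summit.QuantumFields.YangMills.Theorems.CoverSites

open Literature.MathematicalPhysics.QuantumFieldTheory.Balaban1983to89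

variable (P : Params) (jc : ℕ)

/-! ## §1 Pushforward along `π` (sum over the fibres), adjointness, shift-equivariance -/

section Push

variable {M : Type*} [AddCommMonoid M]

/-- **THE PUSHFORWARD OF A SITE FUNCTION** `(π_* g)(x) := Σ_{x̃ ∈ π⁻¹ x} g x̃` — the adjoint of the pullback `f ↦ f ∘ π` for the counting pairings
(`sum_pullback_mul_eq_sum_mul_push`). [folklore] -/
def push (i : ℕ) (g : Site (cover P jc) i → M) (x : Site P i) : M :=
  ∑ xt ∈ Finset.univ.filter (fun xt : Site (cover P jc) i => proj P jc i xt = x), g xt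

/-- `push` unfolded. [folklore] -/
theorem push_apply (i : ℕ) (g : Site (cover P jc) i → M) (x : Site P i) :
    push P jc i g x = ∑ xt ∈ Finset.univ.filter (fun xt : Site (cover P jc) i => proj P jc i xt = x), g xt := rfl

/-- a sum over the cover is the sum downstairs of the pushforward. [folklore] -/
theorem sum_cover_site_eq_sum_push (i : ℕ) (g : Site (cover P jc) i → M) : ∑ xt, g xt = ∑ x, push P jc i g x :=
  (Finset.sum_fiberwise_of_maps_to (s := Finset.univ) (t := Finset.univ) (g := proj P jc i) (fun _ _ => Finset.mem_univ _) g).symm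

/-- `π_*` is additive. [folklore] -/
theorem push_add (i : ℕ) (g h : Site (cover P jc) i → M) (x : Site P i) :
    push P jc i (fun xt => g xt + h xt) x = push P jc i g x + push P jc i h x := by
  rw [push_apply, push_apply, push_apply, Finset.sum_add_distrib]

/-- **`π_* π^* = deg`**: the pushforward of a pulled-back function is `(L^{jc})^d` times the function (`i ≤ m + K`). [folklore] -/
theorem push_comp_proj (i : ℕ) (hi : i ≤ P.m + P.K) (f : Site P i → M) (x : Site P i) :
    push P jc i (fun xt => f (proj P jc i xt)) x = ((P.L ^ jc) ^ P.d) • f x := by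
  rw [push_apply, ← card_fibre_site P jc i hi x, ← Finset.sum_const]
  exact Finset.sum_congr rfl fun xt hxt => by rw [(Finset.mem_filter.mp hxt).2]

/-- **ADJOINTNESS** `⟪f ∘ π, g⟫ = ⟪f, π_* g⟫` for the counting pairing: `Σ_{x̃} f(π x̃)·g(x̃) = Σ_x f(x)·(π_* g)(x)`. [folklore] -/
theorem sum_pullback_mul_eq_sum_mul_push {R : Type*} [NonUnitalNonAssocSemiring R] (i : ℕ) (f : Site P i → R) (g : Site (cover P jc) i → R) :
    ∑ xt, f (proj P jc i xt) * g xt = ∑ x, f x * push P jc i g x := by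
  rw [sum_cover_site_eq_sum_push P jc i (fun xt => f (proj P jc i xt) * g xt)]
  refine Finset.sum_congr rfl fun x _ => ?_
  rw [push_apply, push_apply, Finset.mul_sum]
  exact Finset.sum_congr rfl fun xt hxt => by rw [(Finset.mem_filter.mp hxt).2]

/-- **SHIFT-EQUIVARIANCE OF THE FIBRES**: `(π_* g)(x + e_μ) = (π_* (g(· + e_μ)))(x)` — the fibre of `x + e_μ` is the shifted fibre of `x` (`π` commutes with the
bijections `shift μ`∕`unshift μ`). [folklore] -/
theorem push_shift (i : ℕ) (g : Site (cover P jc) i → M) (x : Site P i) (μ : Fin P.d) :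
    push P jc i g (x.shift μ) = push P jc i (fun xt => g (xt.shift μ)) x := by
  rw [push_apply, push_apply]
  symm
  refine Finset.sum_nbij' (fun xt => xt.shift μ) (fun xt => xt.unshift μ) ?_ ?_ ?_ ?_ ?_
  · intro a ha
    simp only [Finset.mem_filter, Finset.mem_univ, true_and] at ha ⊢
    rw [proj_shift, ha]
  · intro a ha
    simp only [Finset.mem_filter, Finset.mem_univ, true_and] at ha ⊢
    rw [proj_unshift, ha, Site.unshift_shift]
  · intro a _; exact Site.unshift_shift a μ
  · intro a _; exact Site.shift_unshift a μ
  · intro a _; rfl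

/-- the same for the backward shift: `(π_* g)(x − e_μ) = (π_* (g(· − e_μ)))(x)`. [folklore] -/
theorem push_unshift (i : ℕ) (g : Site (cover P jc) i → M) (x : Site P i) (μ : Fin P.d) :
    push P jc i g (x.unshift μ) = push P jc i (fun xt => g (xt.unshift μ)) x := by
  rw [push_apply, push_apply]
  symm
  refine Finset.sum_nbij' (fun xt => xt.unshift μ) (fun xt => xt.shift μ) ?_ ?_ ?_ ?_ ?_
  · intro a ha
    simp only [Finset.mem_filter, Finset.mem_univ, true_and] at ha ⊢
    rw [proj_unshift, ha]
  · intro a ha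
    simp only [Finset.mem_filter, Finset.mem_univ, true_and] at ha ⊢
    rw [proj_shift, ha, Site.shift_unshift]
  · intro a _; exact Site.shift_unshift a μ
  · intro a _; exact Site.unshift_shift a μ
  · intro a _; rfl

/-- **THE PUSHFORWARD OF A BOND FUNCTION** `(π_* g)(b) := Σ_{b̃ ∈ π⁻¹ b} g b̃`. [folklore] -/
def pushBond (i : ℕ) [DecidableEq (PBond P i)] (g : PBond (cover P jc) i → M) (b : PBond P i) : M :=
  ∑ bt ∈ Finset.univ.filter (fun bt : PBond (cover P jc) i => projBond P jc i bt = b), g bt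

/-- `pushBond` unfolded. [folklore] -/
theorem pushBond_apply (i : ℕ) [DecidableEq (PBond P i)] (g : PBond (cover P jc) i → M) (b : PBond P i) :
    pushBond P jc i g b = ∑ bt ∈ Finset.univ.filter (fun bt : PBond (cover P jc) i => projBond P jc i bt = b), g bt := rfl

/-- a bond sum over the cover is the sum downstairs of the pushforward (= `sum_cover_eq_sum_fibre`). [folklore] -/
theorem sum_cover_bond_eq_sum_pushBond (i : ℕ) [DecidableEq (PBond P i)] (g : PBond (cover P jc) i → M) :
    ∑ bt, g bt = ∑ b, pushBond P jc i g b :=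
  sum_cover_eq_sum_fibre P jc i g

/-- `π_* π^* = deg` on bonds (`i ≤ m + K`). [folklore] -/
theorem pushBond_comp_projBond (i : ℕ) [DecidableEq (PBond P i)] (hi : i ≤ P.m + P.K) (f : PBond P i → M) (b : PBond P i) :
    pushBond P jc i (fun bt => f (projBond P jc i bt)) b = ((P.L ^ jc) ^ P.d) • f b := by
  rw [pushBond_apply, ← card_fibre_bond P jc i hi b, ← Finset.sum_const]
  exact Finset.sum_congr rfl fun bt hbt => by rw [(Finset.mem_filter.mp hbt).2]

/-- **ADJOINTNESS ON BONDS** `⟪f ∘ π, g⟫ = ⟪f, π_* g⟫`. [folklore] -/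
theorem sum_pullback_mul_eq_sum_mul_pushBond {R : Type*} [NonUnitalNonAssocSemiring R] (i : ℕ) [DecidableEq (PBond P i)]
    (f : PBond P i → R) (g : PBond (cover P jc) i → R) :
    ∑ bt, f (projBond P jc i bt) * g bt = ∑ b, f b * pushBond P jc i g b := by
  rw [sum_cover_bond_eq_sum_pushBond P jc i (fun bt => f (projBond P jc i bt) * g bt)]
  refine Finset.sum_congr rfl fun b _ => ?_
  rw [pushBond_apply, pushBond_apply, Finset.mul_sum]
  exact Finset.sum_congr rfl fun bt hbt => by rw [(Finset.mem_filter.mp hbt).2]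


/-- **BRIDGE TO THE SUBTYPE-SUM CONVENTION** (LEAD's `…CoverAverages`∕★w1-20520's `adjoint_onE_funLeft_apply`): the filter-sum pushforward IS the sum over the
fibre subtype, `(π_* g)(x) = Σ_{x̃ : {x̃ // π x̃ = x}} g x̃`. [folklore] -/
theorem push_eq_sum_subtype (i : ℕ) (g : Site (cover P jc) i → M) (x : Site P i) :
    push P jc i g x = ∑ xt : {xt : Site (cover P jc) i // proj P jc i xt = x}, g xt.1 := by
  rw [push_apply]
  exact Finset.sum_subtype _ (fun xt => by simp only [Finset.mem_filter, Finset.mem_univ, true_and]) _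

/-- the same bridge on bonds: `(π_* g)(b) = Σ_{b̃ : {b̃ // π b̃ = b}} g b̃`. [folklore] -/
theorem pushBond_eq_sum_subtype (i : ℕ) [DecidableEq (PBond P i)] (g : PBond (cover P jc) i → M) (b : PBond P i) :
    pushBond P jc i g b = ∑ bt : {bt : PBond (cover P jc) i // projBond P jc i bt = b}, g bt.1 := by
  rw [pushBond_apply]
  exact Finset.sum_subtype _ (fun bt => by simp only [Finset.mem_filter, Finset.mem_univ, true_and]) _

/-- a sum over the cover as a sum of SUBTYPE fibre sums (the shape of LEAD's `siteAvgIter_push`∕`bondAvgIter_push` hypotheses). [folklore] -/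
theorem sum_cover_site_eq_sum_subtype (i : ℕ) (g : Site (cover P jc) i → M) :
    ∑ xt, g xt = ∑ x, ∑ xt : {xt : Site (cover P jc) i // proj P jc i xt = x}, g xt.1 := by
  rw [sum_cover_site_eq_sum_push]
  exact Finset.sum_congr rfl fun x _ => push_eq_sum_subtype P jc i g x

/-- the bond version. [folklore] -/
theorem sum_cover_bond_eq_sum_subtype (i : ℕ) [DecidableEq (PBond P i)] (g : PBond (cover P jc) i → M) :
    ∑ bt, g bt = ∑ b, ∑ bt : {bt : PBond (cover P jc) i // projBond P jc i bt = b}, g bt.1 := by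
  rw [sum_cover_bond_eq_sum_pushBond]
  exact Finset.sum_congr rfl fun b _ => pushBond_eq_sum_subtype P jc i g b

end Push

end Summit.QuantumFields.YangMills.Theorems.CoverSites
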